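import Summits.ValiantsHypothesis.ValiantsHypothesis.Theorems.GrenetZeonDualUnipotentThreeHalvesHeavyTopHalfSpeedSeam
import Summits.ValiantsHypothesis.ValiantsHypothesis.Theorems.GrenetZeonDualUnipotentThreeHalvesHeavyTopHalfSpeedSeamCodim

/-!
# `GrenetZeon.DualUnipotentThreeHalves` (stmt-ValiantsHypothesis-24318), LINE β `half_speed`, stub K1 (ii-LOOP) — the BASE CASE
# of the chain loop: one level (a certificate for a reindexed copy of the whole space transports, codimension included)

`exists_halfSpeed_one_level`: if `e : κ ≃ ι` and every member of `U ≤ M_ι(ℂ)` reindexes into `U₀ ≤ M_κ(ℂ)`, then a certificate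
`T₀ ≤ U₀` at height `Θ` yields `T ≤ U` at height `Θ` with `finrank U + finrank T₀ ≤ finrank T + finrank U₀`
(`T = {A ∈ U : reindex A ∈ T₀}`; ✓ `halfSpeed_reindex`, ✓ `finrank_map_mkQ_add`); and `exists_seam_submodule_pred`, the
PREDICATE form of ✓ `exists_seam_submodule` (blocks `A.toBlock p p`, `A.toBlock ¬p ¬p` on `ι` itself — the currency of ✓
`halfSpeed_of_two_levels`, i.e. of the loop's induction step).  The first is the `L = 1` case of the loop
`exists_halfSpeed_chain` (statement staged: `pub/val-lit/lmr/staged/port3g2-halfspeed/HalfSpeedLoop.lean`, desk #332 inheritance).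
Honest framing: plumbing for a stub of LINE β; nothing here proves `HalfSpeedLaw`, `HalfSpeedIrrLaw`, `HeavyTopLaw`, 24318, S3b or
8062; `VP ≠ VNP` is not moved; no summit statement is proved here.  No definitions, no named facts. [β card K1; val-port-3 g2]
-/

noncomputable section

-- single-conjunct layout: Sub = Summit, duplicated namespace component intended
set_option linter.dupNamespace false

namespace Summit.ValiantsHypothesis.ValiantsHypothesis.Theorems.GrenetZeon.HalfSpeed

open Matrix

/-- **ONE LEVEL** (base case of the chain loop, transport form): if `e : κ ≃ ι` identifies the single block with the whole index type, a certificate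
for the block space transports to `U` with the codimension identity. -/
theorem exists_halfSpeed_one_level {ι κ : Type*} [Fintype ι] [Fintype κ] [DecidableEq ι] [DecidableEq κ] (e : κ ≃ ι)
    (Θ : ℕ) (U : Submodule ℂ (Matrix ι ι ℂ)) (U₀ T₀ : Submodule ℂ (Matrix κ κ ℂ))
    (hU₀ : ∀ A ∈ U, Matrix.reindex e.symm e.symm A ∈ U₀) (hT₀ : T₀ ≤ U₀)
    (h₀ : HalfSpeed Θ (U₀ : Set (Matrix κ κ ℂ)) T₀) :
    ∃ T : Submodule ℂ (Matrix ι ι ℂ), T ≤ U ∧ HalfSpeed Θ (U : Set (Matrix ι ι ℂ)) T ∧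
      Module.finrank ℂ U + Module.finrank ℂ T₀ ≤ Module.finrank ℂ T + Module.finrank ℂ U₀ := by
  -- the reindexing as a linear map
  let r : Matrix ι ι ℂ →ₗ[ℂ] Matrix κ κ ℂ := (Matrix.reindexLinearEquiv ℂ ℂ e.symm e.symm).toLinearMap
  have hr : ∀ A, r A = Matrix.reindex e.symm e.symm A := fun A => rfl
  let q : U →ₗ[ℂ] Matrix κ κ ℂ ⧸ T₀ := T₀.mkQ ∘ₗ r ∘ₗ U.subtype
  refine ⟨(LinearMap.ker q).map U.subtype, ?_, ?_, ?_⟩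
  · intro A hA
    obtain ⟨x, -, rfl⟩ := Submodule.mem_map.1 hA
    exact x.2
  · -- profile: transport `h₀` along `e` and shrink
    have hmemT : ∀ A, A ∈ (LinearMap.ker q).map U.subtype → Matrix.reindex e.symm e.symm A ∈ T₀ := by
      intro A hA
      obtain ⟨x, hx, rfl⟩ := Submodule.mem_map.1 hA
      rw [LinearMap.mem_ker] at hx
      have : T₀.mkQ (r (x : Matrix ι ι ℂ)) = 0 := hx
      rwa [Submodule.mkQ_apply, Submodule.Quotient.mk_eq_zero, hr] at this
    have hback := halfSpeed_reindex e Θ _ _ h₀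
    refine halfSpeed_anti ?_ ?_ hback
    · intro A hA
      exact ⟨_, hU₀ A hA, by simp⟩
    · intro A hA
      exact ⟨_, hmemT A hA, by simp⟩
  · have hrn := LinearMap.finrank_range_add_finrank_ker q
    have hker : Module.finrank ℂ ((LinearMap.ker q).map U.subtype) = Module.finrank ℂ (LinearMap.ker q) :=
      LinearEquiv.finrank_eq (Submodule.equivMapOfInjective _ U.injective_subtype _).symm
    have hrange : LinearMap.range q ≤ U₀.map T₀.mkQ := by
      rintro _ ⟨x, rfl⟩
      exact Submodule.mem_map.2 ⟨r x, by rw [hr]; exact hU₀ _ x.2, rfl⟩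
    have hle := Submodule.finrank_mono hrange
    have h1 := finrank_map_mkQ_add U₀ T₀ hT₀
    omega

/-- **SEAM CODIMENSION, predicate form** (the shape the loop's induction step uses on `ι` with `p := (lvl · = 0)`):
for `U ≤ M_ι(ℂ)` whose `p`-block lies in `U₁` and `¬p`-block in `U₂`, and `T₁ ≤ U₁`, `T₂ ≤ U₂`, the subspace
`T = {A ∈ U : A|_p ∈ T₁ ∧ A|_{¬p} ∈ T₂}` has `codim_U T ≤ codim T₁ + codim T₂`. [β card K1; cf. ✓ `exists_seam_submodule`] -/
theorem exists_seam_submodule_pred {ι : Type*} [Fintype ι] (p : ι → Prop) [DecidablePred p]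
    (U : Submodule ℂ (Matrix ι ι ℂ))
    (U₁ T₁ : Submodule ℂ (Matrix {i // p i} {i // p i} ℂ)) (U₂ T₂ : Submodule ℂ (Matrix {i // ¬ p i} {i // ¬ p i} ℂ))
    (hU₁ : ∀ A ∈ U, A.toBlock p p ∈ U₁) (hU₂ : ∀ A ∈ U, A.toBlock (fun i => ¬ p i) (fun i => ¬ p i) ∈ U₂)
    (hT₁ : T₁ ≤ U₁) (hT₂ : T₂ ≤ U₂) :
    ∃ T : Submodule ℂ (Matrix ι ι ℂ), T ≤ U ∧
      (∀ A, A ∈ T ↔ A ∈ U ∧ A.toBlock p p ∈ T₁ ∧ A.toBlock (fun i => ¬ p i) (fun i => ¬ p i) ∈ T₂) ∧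
      Module.finrank ℂ U + Module.finrank ℂ T₁ + Module.finrank ℂ T₂ ≤
        Module.finrank ℂ T + Module.finrank ℂ U₁ + Module.finrank ℂ U₂ := by
  let b₁ : Matrix ι ι ℂ →ₗ[ℂ] Matrix {i // p i} {i // p i} ℂ :=
    { toFun := fun A => A.toBlock p p, map_add' := fun _ _ => rfl, map_smul' := fun _ _ => rfl }
  let b₂ : Matrix ι ι ℂ →ₗ[ℂ] Matrix {i // ¬ p i} {i // ¬ p i} ℂ :=
    { toFun := fun A => A.toBlock (fun i => ¬ p i) (fun i => ¬ p i), map_add' := fun _ _ => rfl,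
      map_smul' := fun _ _ => rfl }
  have hb₁ : ∀ A, b₁ A = A.toBlock p p := fun _ => rfl
  have hb₂ : ∀ A, b₂ A = A.toBlock (fun i => ¬ p i) (fun i => ¬ p i) := fun _ => rfl
  let q : U →ₗ[ℂ] (Matrix {i // p i} {i // p i} ℂ ⧸ T₁) × (Matrix {i // ¬ p i} {i // ¬ p i} ℂ ⧸ T₂) :=
    LinearMap.prod (T₁.mkQ ∘ₗ b₁ ∘ₗ U.subtype) (T₂.mkQ ∘ₗ b₂ ∘ₗ U.subtype)
  refine ⟨(LinearMap.ker q).map U.subtype, ?_, ?_, ?_⟩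
  · intro A hA
    obtain ⟨x, -, rfl⟩ := Submodule.mem_map.1 hA
    exact x.2
  · intro A
    constructor
    · intro hA
      obtain ⟨x, hx, rfl⟩ := Submodule.mem_map.1 hA
      rw [LinearMap.mem_ker] at hx
      have h1 : T₁.mkQ (b₁ (x : Matrix ι ι ℂ)) = 0 := congrArg Prod.fst hx
      have h2 : T₂.mkQ (b₂ (x : Matrix ι ι ℂ)) = 0 := congrArg Prod.snd hx
      rw [Submodule.mkQ_apply, Submodule.Quotient.mk_eq_zero] at h1 h2
      exact ⟨x.2, h1, h2⟩
    · rintro ⟨hAU, h1, h2⟩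
      refine Submodule.mem_map.2 ⟨⟨A, hAU⟩, ?_, rfl⟩
      rw [LinearMap.mem_ker]
      ext <;> simp [q, hb₁, hb₂, h1, h2]
  · have hrn := LinearMap.finrank_range_add_finrank_ker q
    have hker : Module.finrank ℂ ((LinearMap.ker q).map U.subtype) = Module.finrank ℂ (LinearMap.ker q) :=
      LinearEquiv.finrank_eq (Submodule.equivMapOfInjective _ U.injective_subtype _).symm
    have hrange : LinearMap.range q ≤ (U₁.map T₁.mkQ).prod (U₂.map T₂.mkQ) := by
      rintro _ ⟨x, rfl⟩
      exact ⟨Submodule.mem_map.2 ⟨b₁ x, hU₁ _ x.2, rfl⟩, Submodule.mem_map.2 ⟨b₂ x, hU₂ _ x.2, rfl⟩⟩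
    have hle := Submodule.finrank_mono hrange
    have hprod : Module.finrank ℂ ((U₁.map T₁.mkQ).prod (U₂.map T₂.mkQ)) ≤
        Module.finrank ℂ (U₁.map T₁.mkQ) + Module.finrank ℂ (U₂.map T₂.mkQ) := by
      rw [LinearMap.prod_eq_sup_map]
      refine (Submodule.finrank_add_le_finrank_add_finrank _ _).trans (le_of_eq ?_)
      rw [← LinearEquiv.finrank_eq (Submodule.equivMapOfInjective _ LinearMap.inl_injective _),
        ← LinearEquiv.finrank_eq (Submodule.equivMapOfInjective _ LinearMap.inr_injective _)]
    have h1 := finrank_map_mkQ_add U₁ T₁ hT₁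
    have h2 := finrank_map_mkQ_add U₂ T₂ hT₂
    omega

end Summit.ValiantsHypothesis.ValiantsHypothesis.Theorems.GrenetZeon.HalfSpeed

end
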